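import Literature.MathematicalPhysics.QuantumFieldTheory.Balaban1983to89.Node00.CanonicalTransportOfRecord
import Literature.MathematicalPhysics.QuantumFieldTheory.Balaban1983to89.Node00.SmallFieldChi29OfRecord

/-!
# NODE 00 — CONTINUITY OF A FIBRE INTEGRAL WHOSE INTEGRAND CARRIES A SHARP CUT-OFF WITH MOVING THRESHOLDS (pointwise-a.e. dominated convergence)

Cell `pub-ymgap` (YM-PLAN Track A), width seat `pub-ymgap-dag-n09-w6` g2 (node N09 [B12]); helper of K1⁷ stmt-QuantumFields-20542 (`--supports`, count-neutral).
[I] = [Balaban1987RG1].  Sequel to `Node00.RegSetOfFibredChart` (p609712): there, §3 `continuousOn_fibreIntegral_of_dominated` asks for ONE `τ`-null set of fibre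
coordinates off which the chart integrand is continuous in the coarse variable on ALL of `U` (Mathlib `continuousOn_of_dominated`).  In [I]'s (2.10) coordinates the
β-input density carries the SHARP small-field factor `χ^{(2.9)} = Π_b χ({|B′(b)| < ε₁})` with `B′ = B₁ + hD_W(B₁)` ((2.10) p. 267): for a fixed fibre coordinate `B₁`
the factor jumps at those coarse fields `W` where some `|B′(b)|` EQUALS `ε₁`, so no single null set serves every `W` — but at each fixed `W₀` the offending `B₁` form a
level set, null in the fibre.  The right tool is therefore dominated convergence POINT BY POINT with a `W₀`-dependent null set.  This module packages it, generically:
* §1 `continuousOn_integral_of_forall_continuousWithinAt_dominated` — `ContinuousOn` on `U` of `x ↦ ∫ F x z dτ` from, AT EACH `x₀ ∈ U`, local measurability, a local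
  integrable bound and `τ`-a.e. continuity of `F · z` at `x₀` within `U` (Mathlib `continuousWithinAt_of_dominated`, pointwise).
* §2 THE MOVING-THRESHOLD MECHANISM — a finite family of continuous «deviation» functions `φ i` and thresholds `c i`: the sharp cut-off `𝟙{∀ i ∈ I, φ i x < c i}` is
  LOCALLY CONSTANT near every point where no `φ i` sits exactly at its threshold (`eventually_forall_lt_iff_of_forall_ne`), hence `𝟙{…}·g` is continuous there
  (`continuousWithinAt_cutoff_mul_of_forall_ne`); with a fibre parameter, if at `x₀` the threshold sets `{z | φ i x₀ z = c i}` are `τ`-null, the cut-off integrand is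
  continuous at `x₀` for `τ`-a.e. `z` (`ae_continuousWithinAt_cutoff_mul`), and §1 applies (`continuousOn_integral_cutoff_mul`).
* §3 AT THE RECORD'S β-SLOT χ (`chiFixed29 ν ε₁` = K0e's `chiFix29OfRecord`, the C4 species of Record13): along ANY displayed chart `Φ` of coarse fields × fibre
  coordinates into step-`k` fields, the fibre integrand `J·(χ^{(2.9)}_k·exp[−GF∕g_k² + A_k])∘Φ` of `Node00.RegSetOfFibredChart` IS such a cut-off integrand with
  deviations `φ b = fluctDevOfRecord ν K k ∘ Φ` over the non-distinguished bonds and threshold `ε₁` (`jacobian_mul_betaInputOfRecord_chiFixed29_eq_cutoff_mul`), so its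
  continuity on `U` — the hypothesis `hgc` of the fibred-chart doors — REDUCES to per-point fibre-nullity of the exact thresholds `{z | fluctDev(Φ(V₀,z)) b = ε₁}`, a.e.
  continuity in `V` of the deviations along the chart, and a.e. continuity + domination of the smooth factor `J·exp[−GF∕g_k² + A_k]∘Φ`
  (`continuousOn_fibreIntegral_betaInput_chiFixed29_of_thresholdNull`).
SIBLING (landed first, Euclidean setting): dag-n09-w2 g3's `Literature/MeasureTheory/Integral/FibreCoordinatesPushforwardDensity.lean` §3 (p611693) has the
product-window form on finite-dimensional real `Y × K` with add-Haar measures — `FibreCoordinates.continuousOn_fibreIntegral_of_ae`,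
`ae_continuousWithinAt_of_null_fibreSet` (threshold SET with null fibre trace), `measure_fibre_inter_zeroSet_eq_zero` ([Mityagin2015] on the fibre).  THIS module is the
form the record side reads: arbitrary first-countable coarse space `X` (at the record `PBond (F.P K) (k+1) → SU N`, not a normed space), arbitrary fibre measure
space `(Z, τ)`, the cut-off as the FINITE-FAMILY predicate `∀ i ∈ I, φ i x < c i` (the literal shape of K0e's `chiFix29OfRecord`), and §3's reduction at the record's χ.
NOT HERE: any chart, any level-set nullity, the continuity of `A_k` along a chart (N07 ∕ the previous step's regular set) (the fibre-variable analogue of the (F2) statements of dag-n09-w1∕w2∕w3 — for the (2.10) chart a statement about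
`B₁ ↦ |(B₁ + hD_W B₁)(b)|` on `ker Q`, the chart seats'), anything of Bałaban's.  HONEST FRAMING: elementary topology + Mathlib's dominated convergence, read as the tool the
(2.10) step needs; no estimate; N09 NOT discharged; K0⁷∕K1⁷ NOT closed; counts unmoved; NOT continuum ∕ ℝ⁴ ∕ OS ∕ mass gap ∕ Clay.  Theorems only: no `def`, `instance`,
`notation`, `sorry`, `axiom`.
-/

noncomputable section

open MeasureTheory Set Filter
open scoped Topology

namespace Literature.MathematicalPhysics.QuantumFieldTheory.Balaban1983to89.Node00

open _root_.Topology _root_.MeasureTheory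

/-! ## §1. Pointwise-a.e. dominated continuity of a parametric integral on a set -/

section Pointwise

variable {X Z E : Type*} [TopologicalSpace X] [FirstCountableTopology X] [MeasurableSpace Z] {τ : Measure Z}
  [NormedAddCommGroup E] [NormedSpace ℝ E]

/-- **DOMINATED CONTINUITY ON A SET, POINT BY POINT.**  `x ↦ ∫ F x z dτ` is continuous on `U` as soon as, AT EACH `x₀ ∈ U`, `F x` is a.e.-strongly measurable for `x`
near `x₀` within `U`, some `τ`-integrable bound dominates `F x` for `x` near `x₀` within `U`, and `F · z` is continuous at `x₀` within `U` for `τ`-a.e. `z` — the null set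
MAY DEPEND ON `x₀` (contrast Mathlib's `continuousOn_of_dominated`, one null set for all of `U`). [cite: Balaban1987RG1, (2.10) p.267 (bookkeeping)] -/
theorem continuousOn_integral_of_forall_continuousWithinAt_dominated {F : X → Z → E} {U : Set X}
    (hmeas : ∀ x₀ ∈ U, ∀ᶠ x in 𝓝[U] x₀, AEStronglyMeasurable (F x) τ)
    (hbound : ∀ x₀ ∈ U, ∃ bound : Z → ℝ, Integrable bound τ ∧ ∀ᶠ x in 𝓝[U] x₀, ∀ᵐ z ∂τ, ‖F x z‖ ≤ bound z)
    (hcont : ∀ x₀ ∈ U, ∀ᵐ z ∂τ, ContinuousWithinAt (fun x => F x z) U x₀) :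
    ContinuousOn (fun x => ∫ z, F x z ∂τ) U := by
  intro x₀ hx₀
  obtain ⟨bound, hbi, hb⟩ := hbound x₀ hx₀
  exact continuousWithinAt_of_dominated (hmeas x₀ hx₀) hb hbi (hcont x₀ hx₀)

/-- The same with ONE integrable bound valid on all of `U` (the common case: `|χ| ≤ 1` times a bounded smooth factor on a compact fibre domain).
[cite: Balaban1987RG1, (2.10) p.267 (bookkeeping)] -/
theorem continuousOn_integral_of_forall_continuousWithinAt_of_bound {F : X → Z → E} {U : Set X}
    (hmeas : ∀ x ∈ U, AEStronglyMeasurable (F x) τ) (bound : Z → ℝ) (hbi : Integrable bound τ)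
    (hb : ∀ x ∈ U, ∀ᵐ z ∂τ, ‖F x z‖ ≤ bound z)
    (hcont : ∀ x₀ ∈ U, ∀ᵐ z ∂τ, ContinuousWithinAt (fun x => F x z) U x₀) :
    ContinuousOn (fun x => ∫ z, F x z ∂τ) U :=
  continuousOn_integral_of_forall_continuousWithinAt_dominated
    (fun _ _ => eventually_nhdsWithin_of_forall fun x hx => hmeas x hx)
    (fun _ _ => ⟨bound, hbi, eventually_nhdsWithin_of_forall fun x hx => hb x hx⟩) hcont

end Pointwise

/-! ## §2. The moving-threshold mechanism: a sharp cut-off on finitely many continuous deviations is locally constant off the exact thresholds -/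

section Cutoff

variable {X ι : Type*} [TopologicalSpace X]

/-- **LOCAL CONSTANCY OF THE SHARP CUT-OFF.**  For finitely many deviation functions `φ i`, `i ∈ I`, continuous at `x₀` within `U` and none sitting EXACTLY at its
threshold at `x₀` (`φ i x₀ ≠ c i`), the predicate «`∀ i ∈ I, φ i x < c i`» has, for `x` near `x₀` within `U`, the value it has at `x₀`.
[cite: Balaban1987RG1, (2.9) p.266 (bookkeeping)] -/
theorem eventually_forall_lt_iff_of_forall_ne {I : Set ι} (hI : I.Finite) {φ : ι → X → ℝ} {c : ι → ℝ} {U : Set X} {x₀ : X}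
    (hφ : ∀ i ∈ I, ContinuousWithinAt (φ i) U x₀) (hne : ∀ i ∈ I, φ i x₀ ≠ c i) :
    ∀ᶠ x in 𝓝[U] x₀, (∀ i ∈ I, φ i x < c i) ↔ (∀ i ∈ I, φ i x₀ < c i) := by
  by_cases h : ∀ i ∈ I, φ i x₀ < c i
  · have hev : ∀ i ∈ I, ∀ᶠ x in 𝓝[U] x₀, φ i x < c i := fun i hi => (hφ i hi).eventually_lt continuousWithinAt_const (h i hi)
    have hall : ∀ᶠ x in 𝓝[U] x₀, ∀ i ∈ I, φ i x < c i := (hI.eventually_all).2 hev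
    exact hall.mono fun x hx => ⟨fun _ => h, fun _ => hx⟩
  · simp only [not_forall, not_lt, exists_prop] at h
    obtain ⟨i, hi, hci⟩ := h
    have hgt : c i < φ i x₀ := lt_of_le_of_ne hci (hne i hi).symm
    have hev : ∀ᶠ x in 𝓝[U] x₀, c i < φ i x := continuousWithinAt_const.eventually_lt (hφ i hi) hgt
    refine hev.mono fun x hx => ⟨fun hall => absurd (hall i hi) (not_lt.2 hx.le), fun hall => absurd (hall i hi) (not_lt.2 hci)⟩

open Classical in
/-- **THE CUT-OFF TIMES A CONTINUOUS FACTOR IS CONTINUOUS OFF THE EXACT THRESHOLDS.** [cite: Balaban1987RG1, (2.9) p.266 and (2.10) p.267 (bookkeeping)] -/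
theorem continuousWithinAt_cutoff_mul_of_forall_ne {I : Set ι} (hI : I.Finite) {φ : ι → X → ℝ} {c : ι → ℝ} {U : Set X} {x₀ : X}
    {g : X → ℝ} (hφ : ∀ i ∈ I, ContinuousWithinAt (φ i) U x₀) (hne : ∀ i ∈ I, φ i x₀ ≠ c i) (hg : ContinuousWithinAt g U x₀) :
    ContinuousWithinAt (fun x => (if ∀ i ∈ I, φ i x < c i then (1 : ℝ) else 0) * g x) U x₀ := by
  have hev := eventually_forall_lt_iff_of_forall_ne hI hφ hne
  have heq : (fun x => (if ∀ i ∈ I, φ i x < c i then (1 : ℝ) else 0) * g x)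
      =ᶠ[𝓝[U] x₀] fun x => (if ∀ i ∈ I, φ i x₀ < c i then (1 : ℝ) else 0) * g x :=
    hev.mono fun x hx => by simp only [hx]
  refine ContinuousWithinAt.congr_of_eventuallyEq ?_ heq (by simp)
  exact continuousWithinAt_const.mul hg

variable {Z : Type*} [MeasurableSpace Z] {τ : Measure Z}

open Classical in
/-- **WITH A FIBRE PARAMETER: a.e. continuity at `x₀` from fibre-nullity of the exact thresholds at `x₀`.**  If for each `i ∈ I` the set of fibre coordinates `z` with
`φ i x₀ z = c i` is `τ`-null, `φ i · z` is continuous at `x₀` within `U` for a.e. `z`, and so is `g · z`, then the cut-off integrand `𝟙{∀ i ∈ I, φ i x z < c i}·g x z` is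
continuous at `x₀` within `U` for `τ`-a.e. `z` — the null set depends on `x₀`. [cite: Balaban1987RG1, (2.9) p.266 and (2.10) p.267 (bookkeeping)] -/
theorem ae_continuousWithinAt_cutoff_mul {I : Set ι} (hI : I.Finite) {φ : ι → X → Z → ℝ} {c : ι → ℝ} {U : Set X} {x₀ : X} {g : X → Z → ℝ}
    (hφ : ∀ i ∈ I, ∀ᵐ z ∂τ, ContinuousWithinAt (fun x => φ i x z) U x₀) (hnull : ∀ i ∈ I, τ {z | φ i x₀ z = c i} = 0)
    (hg : ∀ᵐ z ∂τ, ContinuousWithinAt (fun x => g x z) U x₀) :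
    ∀ᵐ z ∂τ, ContinuousWithinAt (fun x => (if ∀ i ∈ I, φ i x z < c i then (1 : ℝ) else 0) * g x z) U x₀ := by
  have hφ' : ∀ᵐ z ∂τ, ∀ i ∈ I, ContinuousWithinAt (fun x => φ i x z) U x₀ := (hI.eventually_all).2 hφ
  have hne' : ∀ᵐ z ∂τ, ∀ i ∈ I, φ i x₀ z ≠ c i := by
    refine (hI.eventually_all).2 fun i hi => ?_
    have : ∀ᵐ z ∂τ, z ∉ {z | φ i x₀ z = c i} := measure_eq_zero_iff_ae_notMem.1 (hnull i hi)
    exact this.mono fun z hz => hz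
  filter_upwards [hφ', hne', hg] with z hz1 hz2 hz3
  exact continuousWithinAt_cutoff_mul_of_forall_ne hI hz1 hz2 hz3

variable [FirstCountableTopology X]

open Classical in
/-- **CONTINUITY ON `U` OF THE CUT-OFF FIBRE INTEGRAL** `x ↦ ∫ 𝟙{∀ i ∈ I, φ i x z < c i}·g x z dτ(z)`: measurability of the integrands, one `τ`-integrable bound on `U`,
continuity in `x` of the deviations and of `g` for a.e. fibre coordinate, and — AT EVERY `x₀ ∈ U` — `τ`-nullity of the exact-threshold sets `{z | φ i x₀ z = c i}`.  This is
the shape in which [I]'s (2.10) fibre integral is continuous in the coarse field although its `χ^{(2.9)}` factor is a sharp cut-off with `W`-dependent thresholds.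
[cite: Balaban1987RG1, (2.9) p.266 and (2.10) p.267 (bookkeeping)] -/
theorem continuousOn_integral_cutoff_mul {I : Set ι} (hI : I.Finite) {φ : ι → X → Z → ℝ} {c : ι → ℝ} {U : Set X} {g : X → Z → ℝ}
    (hmeas : ∀ x ∈ U, AEStronglyMeasurable (fun z => (if ∀ i ∈ I, φ i x z < c i then (1 : ℝ) else 0) * g x z) τ)
    (bound : Z → ℝ) (hbi : Integrable bound τ) (hb : ∀ x ∈ U, ∀ᵐ z ∂τ, ‖g x z‖ ≤ bound z)
    (hφ : ∀ x₀ ∈ U, ∀ i ∈ I, ∀ᵐ z ∂τ, ContinuousWithinAt (fun x => φ i x z) U x₀)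
    (hnull : ∀ x₀ ∈ U, ∀ i ∈ I, τ {z | φ i x₀ z = c i} = 0)
    (hg : ∀ x₀ ∈ U, ∀ᵐ z ∂τ, ContinuousWithinAt (fun x => g x z) U x₀) :
    ContinuousOn (fun x => ∫ z, (if ∀ i ∈ I, φ i x z < c i then (1 : ℝ) else 0) * g x z ∂τ) U := by
  refine continuousOn_integral_of_forall_continuousWithinAt_of_bound hmeas bound hbi (fun x hx => ?_)
    (fun x₀ hx₀ => ae_continuousWithinAt_cutoff_mul hI (hφ x₀ hx₀) (hnull x₀ hx₀) (hg x₀ hx₀))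
  filter_upwards [hb x hx] with z hz
  have h1 : ‖(if ∀ i ∈ I, φ i x z < c i then (1 : ℝ) else 0)‖ ≤ 1 := by
    split_ifs <;> simp
  calc ‖(if ∀ i ∈ I, φ i x z < c i then (1 : ℝ) else 0) * g x z‖
        = ‖(if ∀ i ∈ I, φ i x z < c i then (1 : ℝ) else 0)‖ * ‖g x z‖ := norm_mul _ _
    _ ≤ 1 * bound z := mul_le_mul h1 hz (norm_nonneg _) zero_le_one
    _ = bound z := one_mul _

end Cutoff

/-! ## §3. At the record's β-slot χ: the fibre integrand of the β-input along a chart is a moving-threshold cut-off integrand -/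

section RecordChi

open B12Eq019ActionBody (integrand integrand_apply)
open T4Continuum (T4Family)

variable {F : T4Family} {N : ℕ} [NeZero N]

open Classical in
/-- **THE β-INPUT ALONG A CHART IS A CUT-OFF INTEGRAND.**  For the C4 species `χ := chiFixed29 ν ε₁` and any `Φ`, `J`:
`J(V,z)·ρ_k(Φ(V,z)) = 𝟙{∀ b ∉ b₀, fluctDev_k(Φ(V,z))(b) < ε₁} · (J(V,z)·exp[−GF_k∕g_k² + A_k](Φ(V,z)))` — deviations `fluctDevOfRecord ν K k ∘ Φ`, thresholds `ε₁`, index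
set the non-distinguished bonds. [cite: Balaban1987RG1, (2.9) p.266 and (0.19) p.255 (bookkeeping)] -/
theorem jacobian_mul_betaInputOfRecord_chiFixed29_eq_cutoff_mul (ν : Stage7Numerics) (ε₁ : ℝ) (T : Transport F N) (K : ℕ) (g : ℕ → ℝ) (k : ℕ)
    {Z : Type*} (Φ : (PBond (F.P K) (k + 1) → SU N) × Z → GaugeField (F.P K) k (SU N)) (J : (PBond (F.P K) (k + 1) → SU N) × Z → ℝ)
    (V : PBond (F.P K) (k + 1) → SU N) (z : Z) :
    J (V, z) * betaInputOfRecord F N T (chiFixed29 F N ν ε₁) K g k (Φ (V, z))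
      = (if ∀ b ∈ {b : PBond (F.P K) k | ¬ IsB0 b}, fluctDevOfRecord F N ν K k (Φ (V, z)) b < ε₁ then (1 : ℝ) else 0) *
          (J (V, z) * Real.exp (-(1 / (g k) ^ 2) * gfOfRecord F N K k (Φ (V, z)) + effActionHT F N T (chiFixed29 F N ν ε₁) K g k (Φ (V, z)))) := by
  have hχ : chiFixed29 F N ν ε₁ K g k (Φ (V, z))
      = if ∀ b ∈ {b : PBond (F.P K) k | ¬ IsB0 b}, fluctDevOfRecord F N ν K k (Φ (V, z)) b < ε₁ then (1 : ℝ) else 0 := by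
    show chiFix29OfRecord F N ν ε₁ K k (Φ (V, z)) = _
    unfold chiFix29OfRecord
    exact if_congr Iff.rfl rfl rfl
  show J (V, z) * integrand (chiFixed29 F N ν ε₁ K g k) (gfOfRecord F N K k) (g k) (effActionHT F N T (chiFixed29 F N ν ε₁) K g k) (Φ (V, z)) = _
  rw [integrand_apply, hχ]
  ring

variable {Z : Type*} [MeasurableSpace Z] {τ : Measure Z}

open Classical in
/-- ★★ **THE FIBRED-CHART DOORS' CONTINUITY HYPOTHESIS `hgc` AT THE RECORD'S χ, REDUCED TO FIBRE-NULLITY OF THE MOVING THRESHOLDS.**  Along any displayed chart `Φ`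
with Jacobian `J` over a set `U` of coarse fields, the fibre integral `V ↦ ∫ J(V,z)·ρ_k(Φ(V,z)) dτ(z)` of the β-input `ρ_k = χ^{(2.9)}_k·exp[−GF_k∕g_k² + A_k]`
(`chiFixed29 ν ε₁` in the χ slot, any transport `T`) is CONTINUOUS ON `U` provided: the integrands are measurable; ONE `τ`-integrable bound dominates the smooth factor
`J·exp[…]∘Φ` on `U`; at each `V₀ ∈ U` and each non-distinguished bond `b`, the deviation `V ↦ fluctDev_k(Φ(V,z))(b)` is continuous at `V₀` within `U` for a.e. `z` and the
EXACT-THRESHOLD SET `{z | fluctDev_k(Φ(V₀,z))(b) = ε₁}` is `τ`-NULL; and the smooth factor is continuous at `V₀` within `U` for a.e. `z`.  (The nullity is the fibre-variable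
analogue of the (F2) statements; the smooth factor's continuity is [B11] Thm 1 ∕ the previous step's regular set — both DISPLAYED.)
[cite: Balaban1987RG1, (2.9) p.266, (2.10) p.267 and (0.19) p.255] -/
theorem continuousOn_fibreIntegral_betaInput_chiFixed29_of_thresholdNull (ν : Stage7Numerics) (ε₁ : ℝ) (T : Transport F N) (K : ℕ) (g : ℕ → ℝ) (k : ℕ)
    (Φ : (PBond (F.P K) (k + 1) → SU N) × Z → GaugeField (F.P K) k (SU N)) (J : (PBond (F.P K) (k + 1) → SU N) × Z → ℝ)
    {U : Set (PBond (F.P K) (k + 1) → SU N)}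
    (hmeas : ∀ V ∈ U, AEStronglyMeasurable (fun z => J (V, z) * betaInputOfRecord F N T (chiFixed29 F N ν ε₁) K g k (Φ (V, z))) τ)
    (bound : Z → ℝ) (hbi : Integrable bound τ)
    (hb : ∀ V ∈ U, ∀ᵐ z ∂τ, ‖J (V, z) * Real.exp (-(1 / (g k) ^ 2) * gfOfRecord F N K k (Φ (V, z)) +
      effActionHT F N T (chiFixed29 F N ν ε₁) K g k (Φ (V, z)))‖ ≤ bound z)
    (hφ : ∀ V₀ ∈ U, ∀ b : PBond (F.P K) k, ¬ IsB0 b → ∀ᵐ z ∂τ, ContinuousWithinAt (fun V => fluctDevOfRecord F N ν K k (Φ (V, z)) b) U V₀)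
    (hnull : ∀ V₀ ∈ U, ∀ b : PBond (F.P K) k, ¬ IsB0 b → τ {z | fluctDevOfRecord F N ν K k (Φ (V₀, z)) b = ε₁} = 0)
    (hg : ∀ V₀ ∈ U, ∀ᵐ z ∂τ, ContinuousWithinAt (fun V => J (V, z) * Real.exp (-(1 / (g k) ^ 2) * gfOfRecord F N K k (Φ (V, z)) +
      effActionHT F N T (chiFixed29 F N ν ε₁) K g k (Φ (V, z)))) U V₀) :
    ContinuousOn (fun V => ∫ z, J (V, z) * betaInputOfRecord F N T (chiFixed29 F N ν ε₁) K g k (Φ (V, z)) ∂τ) U := by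
  have hI : ({b : PBond (F.P K) k | ¬ IsB0 b}).Finite := Set.toFinite _
  have key := continuousOn_integral_cutoff_mul (τ := τ) hI (U := U)
    (φ := fun b V z => fluctDevOfRecord F N ν K k (Φ (V, z)) b) (c := fun _ => ε₁)
    (g := fun V z => J (V, z) * Real.exp (-(1 / (g k) ^ 2) * gfOfRecord F N K k (Φ (V, z)) +
      effActionHT F N T (chiFixed29 F N ν ε₁) K g k (Φ (V, z))))
    (fun V hV => (hmeas V hV).congr (ae_of_all _ fun z => by
      show J (V, z) * betaInputOfRecord F N T (chiFixed29 F N ν ε₁) K g k (Φ (V, z)) = _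
      rw [jacobian_mul_betaInputOfRecord_chiFixed29_eq_cutoff_mul]
      congr!))
    bound hbi hb (fun V₀ hV₀ b hb' => hφ V₀ hV₀ b hb') (fun V₀ hV₀ b hb' => hnull V₀ hV₀ b hb') hg
  refine key.congr fun V _ => integral_congr_ae (ae_of_all _ fun z => ?_)
  show J (V, z) * betaInputOfRecord F N T (chiFixed29 F N ν ε₁) K g k (Φ (V, z)) = _
  rw [jacobian_mul_betaInputOfRecord_chiFixed29_eq_cutoff_mul]
  congr!

end RecordChi

end Literature.MathematicalPhysics.QuantumFieldTheory.Balaban1983to89.Node00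

end
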